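import Literature.Computability.Cryptography.Postselection
import Literature.Computability.Cryptography.ClassBQPComplementProofs
import Literature.Computability.QuantumComplexity.CWrapAssembly
import Literature.Computability.QuantumComplexity.BPPRelSubsetBQPRel
import HarnessLib

/-!
# `BQP ⊆ PostBQP` (proof; trunk CryptoQuantFine, outline Q4)

Second sibling proof file of `Postselection.lean` (theorems only; the named facts stay `def`s
there, D-0014). It discharges the named fact
`Literature.Computability.Cryptography.BQP_subset_PostBQP` (`BQP_subset_PostBQP_holds`).

## Source and proof

S. Aaronson, *Quantum computing, postselection, and probabilistic polynomial-time*,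
Proc. R. Soc. A 461 (2005) 3473–3482 = arXiv:quant-ph/0412187, §3 (arXiv numbering; the
tree's `Postselection.lean` cites the journal's §2), Def. 1: `L ∈ PostBQP` iff a uniform
polynomial-size family, run on `|0⋯0⟩ ⊗ |x⟩`, has "(i) … the first qubit has a nonzero
probability of being measured to be `|1⟩`. (ii) If `x ∈ L`, then conditioned on the first qubit
being `|1⟩`, the second qubit is `|1⟩` with probability at least `2/3`. (iii) If `x ∉ L`, … at
most `1/3`."  The inclusion `BQP ⊆ PostBQP` is the immediate remark that a `BQP` family becomes
a `PostBQP` family once its post-selection qubit is set to the constant `|1⟩` (conditioning on a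
sure event changes nothing); it is contained in Aaronson's Prop. 3,
`PostBQP = BQP^{PostBQP}_{‖, classical} ⊇ BQP`.

As formalised (tree conventions of `Postselection.lean`: output wire `0`, post-selection wire
`1`): the constant flag is written by *classical post-processing* of the measured string,
`⟨x, y⟩ ↦ [y₀, 1]` (an `FP` map assembled from the tree's bricks, `flagFn_mem_FP`), using the
discharged closure of uniform oracle-free Clifford+T families under `FP` pre- and
post-processing (`CWrap.family`, `CWrap.kernelProb_family_ge`, `QuantumComplexity/CWrapKernel.lean`
and `CWrapAssembly.lean`; Bernstein–Vazirani 1997, §8: classical computation is free inside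
quantum machines). For the wrapped family `F'` of the `BQP` family `F` the kernel bound gives
`Pr_{F'}[11⋯] ≥ Pr_F[1⋯] = a` (the acceptance probability of `F`) and `Pr_{F'}[01⋯] ≥ 1 - a`;
the two events are disjoint, so both bounds are equalities, the post-selection probability
`Pr_{F'}[·1⋯] = Pr_{F'}[11⋯] + Pr_{F'}[01⋯]` is `1 > 0`, and the conditional acceptance
probability is `a / 1 = a`, which is `≥ 2/3` on `L` and `≤ 1/3` off `L`. The Born sums
`postselectProbOn`, `jointAcceptProbOn` of `Postselection.lean` are read off the output kernel
through `toReal_outputPMF_map_ofFn` (`CoinFamilyKernel.lean`; Clifford+T is unitary).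

## References

* S. Aaronson, *Quantum computing, postselection, and probabilistic polynomial-time*,
  Proc. R. Soc. A 461 (2005) 3473–3482, doi:10.1098/rspa.2005.1546, arXiv:quant-ph/0412187:
  Def. 1 (`PostBQP`), Prop. 3 (`PostBQP = BQP^{PostBQP}_{‖, classical}`) [Aaronson2005].
* E. Bernstein, U. Vazirani, *Quantum complexity theory*, SIAM J. Comput. 26 (1997), §8
  (classical computation inside quantum machines) [BernsteinVazirani1997].
* M. A. Nielsen, I. L. Chuang, *Quantum Computation and Quantum Information*, CUP 2010, §2.2.5
  (Born rule in the computational basis) [NielsenChuang2010].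
-/

noncomputable section

namespace Literature.Computability.Cryptography

open _root_.Computability Complexity Complexity.Classes QuantumComplexity Complexity.Brick
  Complexity.HashBricks

/-! ### Two-letter prefixes -/

/-- A two-letter word is a prefix iff it lists the first two letters. [folklore] -/
theorem pair_prefix_iff (a b : Bool) (l : List Bool) :
    [a, b] <+: l ↔ l[0]? = some a ∧ l[1]? = some b := by
  cases l with
  | nil => simp
  | cons c l =>
    cases l with
    | nil => simp [List.cons_prefix_cons, eq_comm]
    | cons d l => simp [List.cons_prefix_cons, eq_comm]

/-- Strings starting `11` and strings starting `01` are disjoint events. [folklore] -/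
theorem disjoint_prefix_tt_ft :
    Disjoint {z : List Bool | [true, true] <+: z} {z : List Bool | [false, true] <+: z} := by
  refine Set.disjoint_left.2 fun z h1 h2 => ?_
  simp only [Set.mem_setOf_eq, pair_prefix_iff] at h1 h2
  rw [h1.1] at h2
  exact absurd h2.1 (by simp)

/-- Letter `1` is `true` iff the string starts `11` or `01`. [folklore] -/
theorem setOf_prefix_tt_union_setOf_prefix_ft :
    {z : List Bool | [true, true] <+: z} ∪ {z : List Bool | [false, true] <+: z} =
      {z : List Bool | z[1]? = some true} := by
  ext z
  simp only [Set.mem_union, Set.mem_setOf_eq, pair_prefix_iff]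
  constructor
  · rintro (⟨-, h⟩ | ⟨-, h⟩) <;> exact h
  · intro h
    cases z with
    | nil => simp at h
    | cons b t =>
      cases b
      · exact Or.inr ⟨rfl, h⟩
      · exact Or.inl ⟨rfl, h⟩

/-! ### Kernel bookkeeping: additivity, and the post-selection Born sums read off the kernel -/

/-- **Additivity of the output kernel** on disjoint events (the kernel is a probability
distribution). [folklore] -/
theorem QCircuitFamily.kernelProb_union {G : QGateSet} (F : QCircuitFamily G)
    (A : Language Bool) (x : List Bool) {E₁ E₂ : Set (List Bool)} (h : Disjoint E₁ E₂) :
    F.kernelProb A x (E₁ ∪ E₂) = F.kernelProb A x E₁ + F.kernelProb A x E₂ := by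
  unfold QCircuitFamily.kernelProb
  set q := F.kernel A x
  have hfin : ∀ E : Set (List Bool), q.toOuterMeasure E ≠ ⊤ := fun E =>
    ne_top_of_le_ne_top ENNReal.one_ne_top ((q.toOuterMeasure.mono (Set.subset_univ E)).trans
      ((PMF.toOuterMeasure_apply_eq_one_iff q Set.univ).2 (Set.subset_univ _)).le)
  rw [← ENNReal.toReal_add (hfin E₁) (hfin E₂), PMF.toOuterMeasure_apply,
    PMF.toOuterMeasure_apply, PMF.toOuterMeasure_apply, ← ENNReal.tsum_add]
  congr 1
  exact tsum_congr fun y => congrFun (Set.indicator_union_of_disjoint h ⇑q) y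

/-- **The post-selection wire read off the kernel** (Clifford+T): the probability that letter `1`
of the measured output string is `true` is the post-selection probability `postselectProbOn`
(both are the junk value `0` on registers with fewer than two wires).
[cite: NielsenChuang2010, §2.2.5 (Born rule)] -/
theorem kernelProb_getElem_one_eq_postselectProbOn (F : QCircuitFamily cliffordT)
    (A : Language Bool) (x : List Bool) :
    F.kernelProb A x {y | y[1]? = some true} = F.postselectProbOn A x := by
  classical
  unfold QCircuitFamily.kernelProb QCircuitFamily.kernel QCircuitFamily.postselectProbOn
    QCircuit.postselectProb QCircuit.probEvent
  rw [toReal_outputPMF_map_ofFn, Finset.sum_filter]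
  refine Finset.sum_congr rfl fun z _ => if_congr ?_ rfl rfl
  simp only [Set.mem_setOf_eq, QCircuit.postselectEvent, List.getElem?_ofFn]
  constructor
  · intro h
    by_cases h1 : 1 < x.length + F.ancillas x.length
    · rw [dif_pos h1, Option.some_inj] at h
      exact ⟨h1, h⟩
    · rw [dif_neg h1] at h
      cases h
  · rintro ⟨h1, h⟩
    rw [dif_pos h1, h]

/-- **The joint acceptance event read off the kernel** (Clifford+T): the probability that the
measured output string starts `11` (output wire and post-selection wire both `true`) is the joint
acceptance probability `jointAcceptProbOn`. [cite: NielsenChuang2010, §2.2.5 (Born rule)] -/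
theorem kernelProb_prefix_tt_eq_jointAcceptProbOn (F : QCircuitFamily cliffordT)
    (A : Language Bool) (x : List Bool) :
    F.kernelProb A x {y | [true, true] <+: y} = F.jointAcceptProbOn A x := by
  classical
  unfold QCircuitFamily.kernelProb QCircuitFamily.kernel QCircuitFamily.jointAcceptProbOn
    QCircuit.jointAcceptProb QCircuit.probEvent
  rw [toReal_outputPMF_map_ofFn, Finset.sum_filter]
  refine Finset.sum_congr rfl fun z _ => if_congr ?_ rfl rfl
  simp only [Set.mem_setOf_eq, pair_prefix_iff, QCircuit.jointAcceptEvent, List.getElem?_ofFn]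
  constructor
  · rintro ⟨h0, h1⟩
    by_cases hN : 1 < x.length + F.ancillas x.length
    · rw [dif_pos hN, Option.some_inj] at h1
      rw [dif_pos (by omega), Option.some_inj] at h0
      exact ⟨hN, h0, h1⟩
    · rw [dif_neg hN] at h1
      cases h1
  · rintro ⟨hN, h0, h1⟩
    rw [dif_pos (by omega), dif_pos hN, h0, h1]
    exact ⟨rfl, rfl⟩

/-- The conditional acceptance probability of a family is the quotient of its joint acceptance
and post-selection probabilities (definitional). [cite: Aaronson2005, Def. 1] -/
theorem QCircuitFamily.condAcceptProbOn_eq_div {G : QGateSet} (F : QCircuitFamily G)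
    (A : Language Bool) (x : List Bool) :
    F.condAcceptProbOn A x = F.jointAcceptProbOn A x / F.postselectProbOn A x :=
  rfl

/-! ### The post-processor `⟨x, y⟩ ↦ [y₀, 1]` -/

/-- **The flag post-processor** `⟨x, y⟩ ↦ [y₀, 1]` — keep the verdict bit of the measured
string and append the constant post-selection flag `1`, assembled from the tree's `FP` bricks
(unpair, head bit, constant, fan-out, append) — evaluated on a pair (`y₀ := false` on the empty
string). [folklore] -/
theorem flagFn_boolPair (x y : List Bool) :
    (appendFn ∘ fanoutFn (headBitFn ∘ sndF) (fun _ => [true])) (boolPair x y) =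
      [y.headD false, true] := by
  simp

/-- The flag post-processor `⟨x, y⟩ ↦ [y₀, 1]` is polynomial-time computable. [folklore] -/
theorem flagFn_mem_FP : appendFn ∘ fanoutFn (headBitFn ∘ sndF) (fun _ => [true]) ∈ FP :=
  comp_mem_FP appendFn_mem_FP
    (fanoutFn_mem_FP (comp_mem_FP headBitFn_mem_FP sndF_mem_FP) (const_mem_FP _))

/-! ### The discharge -/

/-- **`BQP ⊆ PostBQP`** — discharge of the named fact `BQP_subset_PostBQP`. Aaronson's Def. 1
asks for a uniform family whose post-selection qubit reads `|1⟩` with nonzero probability and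
whose output qubit, conditioned on that, is correct with probability `≥ 2/3`; a `BQP` family with
the post-selection qubit set to the constant `|1⟩` is such a family (the remark behind
`BQP ⊆ BQP^{PostBQP}_{‖, classical} = PostBQP`, Prop. 3). Formally the flag is written by the
`FP` post-processor `⟨x, y⟩ ↦ [y₀, 1]` through the tree's classical-wrap closure
(`CWrap.family`, Bernstein–Vazirani 1997 §8): the wrapped family starts its output `11` with
probability `≥ a` (the acceptance probability of the given family) and `01` with probability
`≥ 1 - a` (`CWrap.kernelProb_family_ge`), hence post-selects with probability exactly `1` and
accepts conditionally with probability exactly `a`.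
[cite: Aaronson2005, Def. 1 and Prop. 3] -/
theorem BQP_subset_PostBQP_holds : BQP_subset_PostBQP := by
  intro L hL
  obtain ⟨F, hfree, hunif, hF⟩ := ClassBQP.mem_BQP_iff.1 hL
  obtain ⟨P, hPh, hPg, rfl⟩ := CWrap.exists_params
    (show (id : List Bool → List Bool) ∈ FP from PolyTimeComputable.id _) flagFn_mem_FP hunif
  refine ⟨CWrap.family P, CWrap.family_isOracleFree P hfree, CWrap.family_isUniform P hunif,
    fun x => ?_⟩
  set F' : QCircuitFamily cliffordT := CWrap.family P with hF'
  have hx : P.h x = x := by rw [hPh]; rfl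
  have hg : ∀ y : List Bool, P.g (boolPair x y) = [y.headD false, true] := fun y => by
    rw [hPg, flagFn_boolPair]
  -- the wrapped family starts `11` with probability at least the acceptance probability of `F`
  have h1 : P.F.acceptProbOn 0 x ≤ F'.kernelProb 0 x {z | [true, true] <+: z} := by
    have h := CWrap.kernelProb_family_ge P x (fun _ => {y : List Bool | [true] <+: y})
    rw [hx, kernelProb_prefix_true_eq_acceptProbOn] at h
    refine h.trans (F'.kernelProb_mono 0 x ?_)
    rintro z ⟨y, hy, hz⟩
    rw [hg, headD_false_eq_true_of_prefix hy] at hz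
    exact hz
  -- and `01` with probability at least the rejection probability of `F`
  have h0 : 1 - P.F.acceptProbOn 0 x ≤ F'.kernelProb 0 x {z | [false, true] <+: z} := by
    have h := CWrap.kernelProb_family_ge P x (fun _ => {y : List Bool | [true] <+: y}ᶜ)
    have hc := P.F.kernelProb_add_kernelProb_compl 0 x {y : List Bool | [true] <+: y}
    rw [kernelProb_prefix_true_eq_acceptProbOn] at hc
    rw [hx] at h
    have h' : F'.kernelProb 0 x {z | ∃ y ∈ ({y : List Bool | [true] <+: y}ᶜ : Set (List Bool)),
        P.g (boolPair x y) <+: z} ≤ F'.kernelProb 0 x {z | [false, true] <+: z} := by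
      refine F'.kernelProb_mono 0 x ?_
      rintro z ⟨y, hy, hz⟩
      rw [hg, headD_false_eq_false_of_not_prefix hy] at hz
      exact hz
    linarith
  -- the two events are disjoint: both bounds are equalities, `Pr[post = 1] = 1`
  have hle := kernelProb_add_kernelProb_le_one F' 0 x disjoint_prefix_tt_ft
  have hpost : F'.postselectProbOn 0 x =
      F'.kernelProb 0 x {z | [true, true] <+: z} +
        F'.kernelProb 0 x {z | [false, true] <+: z} := by
    rw [← kernelProb_getElem_one_eq_postselectProbOn, ← setOf_prefix_tt_union_setOf_prefix_ft,
      F'.kernelProb_union 0 x disjoint_prefix_tt_ft]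
  have hjoint : F'.jointAcceptProbOn 0 x = F'.kernelProb 0 x {z | [true, true] <+: z} :=
    (kernelProb_prefix_tt_eq_jointAcceptProbOn F' 0 x).symm
  have hpost1 : F'.postselectProbOn 0 x = 1 := by linarith
  have hcond : F'.condAcceptProbOn 0 x = P.F.acceptProbOn 0 x := by
    rw [F'.condAcceptProbOn_eq_div, hpost1, div_one]
    linarith
  refine ⟨by rw [hpost1]; exact one_pos, fun hxL => ?_, fun hxL => ?_⟩
  · rw [hcond]
    exact (hF x).1 hxL
  · rw [hcond]
    exact (hF x).2 hxL

end Literature.Computability.Cryptography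

end
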